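import Summits.MatrixMultiplication.OmegaCensus.STPP222Pow6Routes
import Summits.MatrixMultiplication.OmegaCensus.STPP222Pow4From66

/-!
# ω-census, `N_k` assemblies: the route checker `coveredG shapes k` for ANY number `k` of triples, and its soundness

HONEST FRAMING (pub-omega census; verbatim): lottery ticket; floor = certified bounds/negative ranges.
Census STRUCTURE bookkeeping (question Q7 of the pub-omega cell: the uniform thresholds `N_k`), not progress on `ω`: a
`(2,2,2)^k` family certifies no matrix-multiplication bound of interest.

Generic form of `STPP222Pow5From94Routes.covered5` / `STPP222Pow6Routes.covered6`, parametrised by the number of triples `k` and by a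
list of seed SHAPES (`shapes : List (List ℕ)`, possibly empty): `coveredG shapes k M` checks, for a multiset `M` of prime-power moduli,
EITHER domination of a shape, OR a split `M = A + B` with `(2,2,2)^a` on the `A`-block by a uniform law of the tree — `hostG`: `a = 4`
for order `≥ 66` (`N₄ ≤ 66`, `STPP222Pow4From66`), `3` for `≥ 46`, `2` for `≥ 26`, `1` for `≥ 10` or a dominated `(ℤ/2)³` — and a
tricolored-sum-free set of size `needG k a = ⌈k/a⌉` on the `B`-block (`tsfGEG`: one coordinate with `tsfCycG` — sizes `2,3,4,5,6,7` from
`ℤ/e` for `e ≥ 3, 7, 9, 13, 18, 21`, the size-7 supplies being the NEW kernel instances `ℤ/21, ℤ/22, ℤ/23, ℤ/24` (seat's exhaustive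
searcher `tsf.c`, which also shows COMPLETE negatives `ℤ/16, ℤ/17 ↛ 6` and `ℤ/19, ℤ/20 ↛ 7`, not kernel statements) and the midpoint-free
set `{0,1,3,4,9,10,12}` for `e ≥ 25` —, a coprime pair, a table type (`tablesG`: the order-16 types `→ 6`, `(ℤ/3)³ → 9`), or recursively the
TSF graph / a product of TSF sets of sizes `(2, ⌈t/2⌉)` or `(3, ⌈t/3⌉)` on a split).  `coveredG_sound`: shapes hosting `(2,2,2)^k`
(hypothesis, vacuous for `shapes = []`) and `coveredG shapes k` on the moduli of a block give `(2,2,2)^k ⊆ Π j, ℤ/q j`.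
Decisions using it: `STPP222Pow7From362.lean` (`N₇ ≤ 362`, no shapes).

References: H. Cohn, R. Kleinberg, B. Szegedy, C. Umans, FOCS 2005 (arXiv:math/0511460), Def. 5.1; J. Blasiak et al., Discrete
Analysis 2017:3, Def. 3.1.  Seat pub-omega-stpp-3 (gen 11), 2026-08-25.
-/

open Literature.Computability.AlgebraicComplexity Literature.Combinatorics.Additive Finset

namespace Summit.MatrixMultiplication.OmegaCensus

namespace NkRoutes

open N5Kit N5From94 N6From290

/-! ## 1. Tricolored sum-free supplies -/

/-- The TSF size extracted from `ℤ/e`: `7` for `e ≥ 21`, `6` for `e ≥ 18`, else `tsfCyc e` (`5, 4, 3, 2` for `e ≥ 13, 9, 7, 3`). -/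
def tsfCycG (e : ℕ) : ℕ := if 21 ≤ e then 7 else tsfCyc6 e

/-- **`ℤ/e` carries a tricolored sum-free set of size `tsfCycG e`**: kernel instances `ℤ/21, ℤ/22, ℤ/23, ℤ/24 → 7` (seat search `tsf.c`),
the midpoint-free set `{0,1,3,4,9,10,12}` for `e ≥ 25`, and `hasTSF_zmod_tsfCyc6` below `21`.
[cite: BlasiakChurchCohnGrochowNaslundSawinUmans2017, Def. 3.1] -/
theorem hasTSF_zmod_tsfCycG (e : ℕ) : HasTSF (ZMod e) (tsfCycG e) := by
  unfold tsfCycG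
  by_cases h21 : 21 ≤ e
  · rw [if_pos h21]
    by_cases h25 : 25 ≤ e
    · exact hasTSF_zmod_of_midpointFree ![0, 1, 3, 4, 9, 10, 12] (by decide) (fun i => by fin_cases i <;> simp <;> omega)
    interval_cases e
    · exact ⟨![0, 1, 3, 4, 7, 9, 16], ![0, 1, 3, 10, 8, 9, 4], ![0, 19, 15, 7, 6, 3, 1], by unfold IsTricoloredSumFree; decide⟩
    · exact ⟨![0, 1, 3, 7, 8, 10, 17], ![0, 1, 3, 8, 13, 9, 10], ![0, 20, 16, 7, 1, 3, 17], by unfold IsTricoloredSumFree; decide⟩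
    · exact ⟨![0, 1, 3, 4, 14, 19, 21], ![0, 1, 3, 7, 18, 17, 14], ![0, 21, 17, 12, 14, 10, 11],
        by unfold IsTricoloredSumFree; decide⟩
    · exact ⟨![0, 1, 3, 4, 10, 11, 15], ![0, 1, 3, 4, 10, 12, 18], ![0, 22, 18, 16, 4, 1, 15],
        by unfold IsTricoloredSumFree; decide⟩
  · rw [if_neg h21]
    exact hasTSF_zmod_tsfCyc6 e

/-- Table types with a tricolored sum-free set of the listed size: the four order-16 types (`→ 6`) and `(ℤ/3)³` (`→ 9`, the cap set of
`STPPTricoloredProduct.exists_isTSF_nine_zmod3_cube`). -/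
def tablesG : List (List ℕ × ℕ) := [([4, 4], 6), ([2, 8], 6), ([2, 2, 4], 6), ([2, 2, 2, 2], 6), ([3, 3, 3], 9)]

/-- The table types carry tricolored sum-free sets of the listed sizes. [cite: BlasiakChurchCohnGrochowNaslundSawinUmans2017, Def. 3.1] -/
theorem hasTSF_tablesG : ∀ st ∈ tablesG, HasTSF (SeedType st.1) st.2 := by
  intro st hst
  simp only [tablesG, List.mem_cons, List.not_mem_nil, or_false] at hst
  rcases hst with rfl | rfl | rfl | rfl | rfl
  · exact hasTSF_tables6 [4, 4] (by decide)
  · exact hasTSF_tables6 [2, 8] (by decide)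
  · exact hasTSF_tables6 [2, 2, 4] (by decide)
  · exact hasTSF_tables6 [2, 2, 2, 2] (by decide)
  · obtain ⟨v, hv⟩ := exists_isTSF_nine_zmod3_cube
    exact (⟨v, v, v, hv⟩ : HasTSF (ZMod 3 × ZMod 3 × ZMod 3) 9)

/-! ## 2. The Boolean route checker -/

/-- Base TSF supplies of a block with moduli `B`, size `≥ t`: trivial, one modulus, a coprime pair, or a dominated table type. -/
def tsfBaseG (t : ℕ) (B : Multiset ℕ) : Bool :=
  decide (t ≤ 1) || anyM B (fun x => decide (t ≤ tsfCycG x)) ||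
    anyM B (fun x => anyM (B.erase x) (fun y => decide (Nat.Coprime x y ∧ t ≤ tsfCycG (x * y)))) ||
    tablesG.any (fun st => decide (t ≤ st.2) && dom st.1 B)

/-- TSF supplies with `fuel` levels of splitting: the base supplies, or a split carrying the TSF graph (both parts of order `≥ t`) or a
product of TSF sets of sizes `(2, ⌈t/2⌉)` or `(3, ⌈t/3⌉)`. -/
def tsfGEG : ℕ → ℕ → Multiset ℕ → Bool
  | 0, t, B => tsfBaseG t B
  | fuel + 1, t, B => tsfBaseG t B ||
      anyM B.powerset (fun B₂ => decide (t ≤ B₂.prod ∧ t ≤ (B - B₂).prod) ||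
        (tsfGEG fuel 2 B₂ && tsfGEG fuel ((t + 1) / 2) (B - B₂)) || (tsfGEG fuel 3 B₂ && tsfGEG fuel ((t + 2) / 3) (B - B₂)))

/-- The number `a ≤ 4` of triples the tree's uniform laws put on a block with moduli `A`: `4` for order `≥ 66` (`N₄ ≤ 66`), `3` for
`≥ 46`, `2` for `≥ 26`, `1` for `≥ 10` or a dominated `(ℤ/2)³`, else `0`. -/
def hostG (A : Multiset ℕ) : ℕ :=
  if 66 ≤ A.prod then 4 else if 46 ≤ A.prod then 3 else if 26 ≤ A.prod then 2
    else if 10 ≤ A.prod ∨ dom [2, 2, 2] A = true then 1 else 0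

/-- The number of triples the uniform laws give from the ORDER alone (`hostG` without the `(ℤ/2)³` clause). -/
def hostP (P : ℕ) : ℕ := if 66 ≤ P then 4 else if 46 ≤ P then 3 else if 26 ≤ P then 2 else if 10 ≤ P then 1 else 0

/-- The TSF size needed next to `a` triples for `k`: `⌈k/a⌉`. -/
def needG (k a : ℕ) : ℕ := (k + a - 1) / a

/-- **The route checker for `(2,2,2)^k` with seed shapes `shapes`**: (fast path) ONE modulus `x` as the TSF block (`tsfCycG x`) next to
the uniform law on the rest (order `M.prod / x`); or domination of a shape; or a split `M = A + B` with `hostG A ≠ 0` and a TSF set of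
size `needG k (hostG A)` on `B`. -/
def coveredG (shapes : List (List ℕ)) (k : ℕ) (M : Multiset ℕ) : Bool :=
  anyM M (fun x => decide (hostP (M.prod / x) ≠ 0 ∧ k ≤ hostP (M.prod / x) * tsfCycG x)) ||
  shapes.any (fun s => dom s M) ||
    anyM M.powerset (fun B => decide (hostG (M - B) ≠ 0) && tsfGEG (Multiset.card M) (needG k (hostG (M - B))) B)

/-! ## 3. Soundness -/

variable {ι : Type} [Fintype ι] [DecidableEq ι] {q : ι → ℕ}

omit [Fintype ι] in
/-- From ONE coordinate `i ∈ S`: `ℤ/q i ⊇` a TSF set of size `tsfCycG (q i)`. -/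
theorem tsfOn_singleG (S : Finset ι) {i : ι} (hi : i ∈ S) {t : ℕ} (ht : t ≤ tsfCycG (q i)) : TSFOn q S t := by
  refine ⟨ZMod (q i), inferInstance, AddMonoidHom.single (fun j => ZMod (q j)) i,
    Pi.single_injective (M := fun j => ZMod (q j)) i, ?_, hasTSF_mono ht (hasTSF_zmod_tsfCycG (q i))⟩
  intro x j hj
  have hji : j ≠ i := fun h => hj (h ▸ hi)
  simp [Pi.single_eq_of_ne hji]

omit [Fintype ι] in
/-- From a COPRIME PAIR of coordinates: `ℤ/(q i q i') ⊇` a TSF set of size `tsfCycG (q i q i')`. -/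
theorem tsfOn_pairG (S : Finset ι) {i i' : ι} (hi : i ∈ S) (hi' : i' ∈ S) (hcop : Nat.Coprime (q i) (q i')) {t : ℕ}
    (ht : t ≤ tsfCycG (q i * q i')) : TSFOn q S t := by
  set c : Π j, ZMod (q j) := Pi.single i 1 + Pi.single i' 1 with hcdef
  have ho1 : addOrderOf (Pi.single i (1 : ZMod (q i)) : Π j, ZMod (q j)) = q i := by
    rw [← AddMonoidHom.single_apply, addOrderOf_injective _ (Pi.single_injective (M := fun j => ZMod (q j)) i),
      ZMod.addOrderOf_one]
  have ho2 : addOrderOf (Pi.single i' (1 : ZMod (q i')) : Π j, ZMod (q j)) = q i' := by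
    rw [← AddMonoidHom.single_apply, addOrderOf_injective _ (Pi.single_injective (M := fun j => ZMod (q j)) i'),
      ZMod.addOrderOf_one]
  have hord : addOrderOf c = q i * q i' := by
    rw [hcdef, AddCommute.addOrderOf_add_eq_mul_addOrderOf_of_coprime (AddCommute.all _ _) (by rwa [ho1, ho2]), ho1, ho2]
  have hsupp : ∀ j ∉ S, c j = 0 := by
    intro j hj
    have h1 : j ≠ i := fun h => hj (h ▸ hi)
    have h2 : j ≠ i' := fun h => hj (h ▸ hi')
    simp [hcdef, Pi.single_eq_of_ne h1, Pi.single_eq_of_ne h2]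
  obtain ⟨φ, hφ, hφs⟩ := exists_emb_of_elem S c hsupp hord
  exact ⟨_, inferInstance, φ, hφ, hφs, hasTSF_mono ht (hasTSF_zmod_tsfCycG _)⟩

omit [Fintype ι] in
/-- Soundness of the base supplies. -/
theorem tsfBaseG_sound (hq : ∀ i, 0 < q i) {t : ℕ} (S : Finset ι) (h : tsfBaseG t (S.val.map q) = true) : TSFOn q S t := by
  simp only [tsfBaseG, Bool.or_eq_true, Bool.and_eq_true, decide_eq_true_eq, anyM_iff, List.any_eq_true] at h
  rcases h with ((h1 | ⟨x, hx, hxt⟩) | ⟨x, hx, y, hy, hcop, hyt⟩) | ⟨st, hst, hle, hdom⟩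
  · exact tsfOn_of_le_one S h1
  · obtain ⟨i, hi, rfl⟩ := Multiset.mem_map.1 hx
    exact tsfOn_singleG S hi hxt
  · obtain ⟨i, hi, rfl⟩ := Multiset.mem_map.1 hx
    obtain ⟨i', hi', rfl⟩ := Multiset.mem_map.1 (Multiset.mem_of_mem_erase hy)
    exact tsfOn_pairG S hi hi' hcop hyt
  · exact (tsfOn_of_dom hq S hdom (hasTSF_tablesG st hst)).mono (Subset.refl _) hle

/-- Soundness of `tsfGEG`. -/
theorem tsfGEG_sound (hq : ∀ i, 0 < q i) : ∀ (fuel t : ℕ) (S : Finset ι), tsfGEG fuel t (S.val.map q) = true → TSFOn q S t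
  | 0, _, S, h => tsfBaseG_sound hq S h
  | fuel + 1, t, S, h => by
      rw [tsfGEG, Bool.or_eq_true] at h
      rcases h with h | h
      · exact tsfBaseG_sound hq S h
      rw [anyM_iff] at h
      obtain ⟨B₂, hB₂, h⟩ := h
      rw [Multiset.mem_powerset] at hB₂
      obtain ⟨T, hTS, hT⟩ := exists_subset_map_eq q S B₂ hB₂
      have hdiff : S.val.map q - B₂ = (S \ T).val.map q := by rw [← hT, map_val_sdiff q hTS]
      have hun : T ∪ S \ T = S := Finset.union_sdiff_of_subset hTS
      rw [hdiff, ← hT, Bool.or_eq_true, Bool.or_eq_true, decide_eq_true_eq, Bool.and_eq_true, Bool.and_eq_true] at h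
      rw [← hun]
      rcases h with (⟨h2, h3⟩ | ⟨h2, h3⟩) | ⟨h2, h3⟩
      · exact tsfOn_graph hq Finset.disjoint_sdiff h2 h3
      · exact (tsfOn_mul Finset.disjoint_sdiff (tsfGEG_sound hq fuel 2 T h2) (tsfGEG_sound hq fuel _ (S \ T) h3)).mono
          (Subset.refl _) (by omega)
      · exact (tsfOn_mul Finset.disjoint_sdiff (tsfGEG_sound hq fuel 3 T h2) (tsfGEG_sound hq fuel _ (S \ T) h3)).mono
          (Subset.refl _) (by omega)

/-- `hostG` never exceeds `4`. -/
theorem hostG_le (A : Multiset ℕ) : hostG A ≤ 4 := by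
  unfold hostG; split_ifs <;> omega

/-- `a · needG k a ≥ k` for `1 ≤ a ≤ 4`. -/
theorem le_mul_needG (k : ℕ) {a : ℕ} (h0 : a ≠ 0) (h4 : a ≤ 4) : k ≤ a * needG k a := by
  have h1 : 1 ≤ a := Nat.pos_of_ne_zero h0
  unfold needG; interval_cases a <;> omega

/-- `(2,2,2)⁴` on a block of order `≥ 66` (`N₄ ≤ 66`, `exists_isSTPP_222pow4_of_card_ge66`). [cite: CohnKleinbergSzegedyUmans2005, Def. 5.1] -/
theorem stppOn_four (hq : ∀ i, 0 < q i) (S : Finset ι) (hS : 66 ≤ (S.val.map q).prod) : STPPOn q S 4 :=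
  stppOn_of_law hq S (fun h => exists_isSTPP_222pow4_of_card_ge66 h) hS

/-- `hostP` never exceeds `4`. -/
theorem hostP_le (P : ℕ) : hostP P ≤ 4 := by
  unfold hostP; split_ifs <;> omega

/-- Soundness of `hostP`: the uniform laws on a block of the given order. -/
theorem stppOn_hostP (hq : ∀ i, 0 < q i) (S : Finset ι) (h : hostP (S.val.map q).prod ≠ 0) :
    STPPOn q S (hostP (S.val.map q).prod) := by
  unfold hostP at h ⊢
  split_ifs at h ⊢ with h66 h46 h26 h10
  · exact stppOn_four hq S h66
  · exact stppOn_three hq S h46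
  · exact stppOn_two hq S h26
  · exact stppOn_one hq S h10
  · exact absurd rfl h

/-- Soundness of `hostG`: the uniform laws on the block. -/
theorem stppOn_hostG (hq : ∀ i, 0 < q i) (S : Finset ι) (h : hostG (S.val.map q) ≠ 0) :
    STPPOn q S (hostG (S.val.map q)) := by
  unfold hostG at h ⊢
  split_ifs at h ⊢ with h66 h46 h26 h10
  · exact stppOn_four hq S h66
  · exact stppOn_three hq S h46
  · exact stppOn_two hq S h26
  · rcases h10 with h10 | hdom
    · exact stppOn_one hq S h10
    · exact stppOn_of_dom222 hq S hdom
  · exact absurd rfl h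

/-- **Soundness of the generic route checker**: if every shape hosts `(2,2,2)^k` and the multiset of moduli of a block `S` passes
`coveredG shapes k`, then `(2,2,2)^k ⊆ Π j, ℤ/q j`. [cite: CohnKleinbergSzegedyUmans2005, Def. 5.1] -/
theorem coveredG_sound {shapes : List (List ℕ)} {k : ℕ} (hshapes : ∀ s ∈ shapes, HasPow (SeedType s) k) (hq : ∀ i, 0 < q i)
    (S : Finset ι) (h : coveredG shapes k (S.val.map q) = true) : HasPow (Π j, ZMod (q j)) k := by
  simp only [coveredG, Bool.or_eq_true, Bool.and_eq_true, decide_eq_true_eq, anyM_iff, List.any_eq_true] at h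
  rcases h with (⟨x, hx, hh0, hk⟩ | ⟨s, hs, hdom⟩) | ⟨B, hB, hhost, htsf⟩
  · -- fast path: the TSF block is the single coordinate `i`, the law block is `S \ {i}`
    obtain ⟨i, hi, rfl⟩ := Multiset.mem_map.1 hx
    have hsub : ({i} : Finset ι) ⊆ S := Finset.singleton_subset_iff.2 hi
    have hrest : (S.val.map q).prod / q i = ((S \ {i}).val.map q).prod := by
      have hmul : (S.val.map q).prod = q i * ((S \ {i}).val.map q).prod := by
        rw [map_val_sdiff q hsub, ← Multiset.prod_erase hx]
        congr 1
        simp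
      rw [hmul, Nat.mul_div_cancel_left _ (hq i)]
    rw [hrest] at hh0 hk
    exact hasPow_of_parts_le Finset.sdiff_disjoint (stppOn_hostP hq _ hh0)
      (tsfOn_singleG {i} (Finset.mem_singleton_self i) le_rfl) hk
  · exact hasPow_of_dom hq S hdom (hshapes s hs)
  · rw [Multiset.mem_powerset] at hB
    obtain ⟨T, hTS, hT⟩ := exists_subset_map_eq q S B hB
    have hdiff : S.val.map q - B = (S \ T).val.map q := by rw [← hT, map_val_sdiff q hTS]
    rw [hdiff] at hhost htsf
    rw [← hT] at htsf
    exact hasPow_of_parts_le Finset.sdiff_disjoint (stppOn_hostG hq (S \ T) hhost) (tsfGEG_sound hq _ _ T htsf)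
      (le_mul_needG k hhost (hostG_le _))

end NkRoutes

end Summit.MatrixMultiplication.OmegaCensus
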